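import Summits.ValiantsHypothesis.ValiantsHypothesis.Theorems.LacunarySymmetroidMatrixDescartesCensusDoorA34SheetHyperbolicBlocks
import Summits.ValiantsHypothesis.ValiantsHypothesis.Theorems.LacunarySymmetroidMatrixDescartesCensusWindowFourInterlacing

/-!
# `MatrixDescartes` census — DOOR A at `(3,4)`: on the SUB-SUB-STRATUM of the hyperbolic cell (kernel vector isotropic for all three core letters) the
# MIDDLE WINDOW is `−(A·B)/|k|⁴` with `A, B` TRINOMIALS, hence has at most FOUR positive roots

HONEST FRAMING.  Object-search cell `pub-symmetroid`, engine seat `val-sym-eng-2` (g7); helper row beside the registered strata line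
`Cruxes/DoorA34/Lines/strata.lean` on stmt-ValiantsHypothesis-19980 (`DoorA34 = PosRootLawAt 3 4 18`: OPEN, typed, never asserted here), stub
`stub_nullTopCeiling`, INDEFINITE cell; the exact kernel skeleton of regime (II) of the seat's INDEFINITE WINDOW LAW (report HOME/DOOR-A34-ENG2G7-REPORT.md §2,
crux note `Cruxes/DoorA34/Lines/strata-indefinite-window.md`).  For the `(3,4)` pencil with symmetric letters, top letter `S₃ = h·(vwᵀ + wvᵀ)`, `k = v × w`:

* `card_posRoots_mul_le_four` — a product of two polynomials with `≤ 3` monomials each has `≤ 4` positive roots (the tree's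
  `card_posRoots_le_two_of_card_support_le_three` from …WindowFourInterlacing + `roots_mul`);
* `middleBlock_mul_normSq_sq_eq_neg_mul_of_isotropic` — **SUB-SUB-STRATUM FACTORISATION (polynomials)**: if `kᵀS_lk = 0` for `l = 0, 1, 2`, then
  `C((k·k)²)·(v̂ᵀ adj(G) ŵ) = −A·B` with the TRINOMIALS `A = Σ_l C(kᵀS_l(v×k))·X^{d_l}`, `B = Σ_l C(((w×k)ᵀS_l k))·X^{d_l}` (…SheetHyperbolicIsotropic's
  `adjugate_bilin_factor_of_isotropic` over `ℝ[X]`);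
* **`card_posRoots_middleBlock_le_four_of_isotropic`** — hence, for `k ≠ 0`, the middle block has at most FOUR positive roots on that stratum (one fewer
  than the generic `≤ 5` of …SheetHyperbolicBlocks): the window budget `γ_M ≤ 4` of regime (II) is exact there.

On this stratum the top block `kᵀGk` vanishes identically, so the sheet determinant has `≤ 16` monomials and `≤ 15` positive roots outright; the row's use
is as the exact anchor of the NEARBY regime («`|k|⁴m = −A·B + O(T)`»).  Nothing here bounds `ζ_sym(3,4)`; `DoorA34` and the three stubs stay OPEN; nothing on
`MatrixDescartes` (stmt-ValiantsHypothesis-18050) or `VP ≠ VNP` — VP≠VNP not moved.  [folklore] sparse Descartes; elementary.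
-/

-- `Summit.ValiantsHypothesis.ValiantsHypothesis.…` repeats a component by the D-0017 layout
-- (single-conjunct summit), which the `dupNamespace` linter flags; the name is mandated.
set_option linter.dupNamespace false

namespace Summit.ValiantsHypothesis.ValiantsHypothesis.Theorems.LacunarySymmetroidMatrixDescartes.Census

open Polynomial Finset
open scoped BigOperators Polynomial Matrix
open Matrix

/-! ## 1. Trinomials and their products -/

/-- A product of two non-zero real polynomials with at most three monomials each has at most four positive roots. [folklore] -/
theorem card_posRoots_mul_le_four {A B : ℝ[X]} (hA : A ≠ 0) (hB : B ≠ 0) (hA3 : A.support.card ≤ 3) (hB3 : B.support.card ≤ 3) :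
    ((A * B).roots.toFinset.filter (fun t => 0 < t)).card ≤ 4 := by
  classical
  rw [Polynomial.roots_mul (mul_ne_zero hA hB), Multiset.toFinset_add, Finset.filter_union]
  calc ((A.roots.toFinset.filter fun t => 0 < t) ∪ (B.roots.toFinset.filter fun t => 0 < t)).card
      ≤ (A.roots.toFinset.filter fun t => 0 < t).card + (B.roots.toFinset.filter fun t => 0 < t).card := Finset.card_union_le _ _
    _ ≤ 2 + 2 := Nat.add_le_add (card_posRoots_le_two_of_card_support_le_three A hA hA3) (card_posRoots_le_two_of_card_support_le_three B hB hB3)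

/-- A node form `Σ_l C(c_l)·X^{d_l}` on three exponents has at most three monomials. [folklore] -/
theorem card_support_nodeForm_three_le (d : Fin 4 → ℕ) (c : Fin 3 → ℝ) :
    (∑ l : Fin 3, C (c l) * (X : ℝ[X]) ^ d (Fin.castSucc l)).support.card ≤ 3 := by
  have hsub : (∑ l : Fin 3, C (c l) * (X : ℝ[X]) ^ d (Fin.castSucc l)).support ⊆ (Finset.univ : Finset (Fin 3)).image (fun l => d (Fin.castSucc l)) := by
    intro n hn
    rw [Polynomial.mem_support_iff, Polynomial.finsetSum_coeff] at hn
    by_contra hni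
    apply hn
    refine Finset.sum_eq_zero fun l _ => ?_
    rw [Polynomial.coeff_C_mul, Polynomial.coeff_X_pow]
    have : n ≠ d (Fin.castSucc l) := fun h => hni (Finset.mem_image.mpr ⟨l, Finset.mem_univ _, h.symm⟩)
    simp [this]
  exact (Finset.card_le_card hsub).trans (Finset.card_image_le.trans (by simp))

/-! ## 2. The sub-sub-stratum factorisation of the middle block -/

/-- **SUB-SUB-STRATUM FACTORISATION**: if `k = v × w` is isotropic for every core letter (`kᵀS_lk = 0`, `l < 3`), then
`C((k·k)²)·(v̂ᵀ adj(G) ŵ) = −A·B` with the trinomials `A = Σ_l C(kᵀS_l(v×k)) X^{d_l}`, `B = Σ_l C((w×k)ᵀS_l k) X^{d_l}`. [folklore] -/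
theorem middleBlock_mul_normSq_sq_eq_neg_mul_of_isotropic (d : Fin 4 → ℕ) (S : Fin 4 → Matrix (Fin 3) (Fin 3) ℝ) (v w : Fin 3 → ℝ)
    (hiso : ∀ l : Fin 3, (v ⨯₃ w) ⬝ᵥ (S (Fin.castSucc l) *ᵥ (v ⨯₃ w)) = 0) :
    C (((v ⨯₃ w) ⬝ᵥ (v ⨯₃ w)) ^ 2) * ((fun i => C (v i)) ⬝ᵥ
        ((∑ l : Fin 3, ((X : ℝ[X]) ^ d (Fin.castSucc l)) • (S (Fin.castSucc l)).map C).adjugate *ᵥ fun i => C (w i)))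
      = -((∑ l : Fin 3, C ((v ⨯₃ w) ⬝ᵥ (S (Fin.castSucc l) *ᵥ (v ⨯₃ (v ⨯₃ w)))) * (X : ℝ[X]) ^ d (Fin.castSucc l))
          * (∑ l : Fin 3, C ((w ⨯₃ (v ⨯₃ w)) ⬝ᵥ (S (Fin.castSucc l) *ᵥ (v ⨯₃ w))) * (X : ℝ[X]) ^ d (Fin.castSucc l))) := by
  set G := (∑ l : Fin 3, ((X : ℝ[X]) ^ d (Fin.castSucc l)) • (S (Fin.castSucc l)).map C) with hG
  -- the ring identity over `ℝ[X]` with the mapped vectors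
  have hid := normSq_sq_mul_adjugate_bilin_eq G (fun i => C (v i)) (fun i => C (w i))
  have hk : (fun i => C (v i)) ⨯₃ (fun i => C (w i)) = fun i => (C ((v ⨯₃ w) i) : ℝ[X]) := cross_map_C v w
  have hvk : (fun i => C (v i)) ⨯₃ (fun i => (C ((v ⨯₃ w) i) : ℝ[X])) = fun i => (C ((v ⨯₃ (v ⨯₃ w)) i) : ℝ[X]) := cross_map_C v (v ⨯₃ w)
  have hwk : (fun i => C (w i)) ⨯₃ (fun i => (C ((v ⨯₃ w) i) : ℝ[X])) = fun i => (C ((w ⨯₃ (v ⨯₃ w)) i) : ℝ[X]) := cross_map_C w (v ⨯₃ w)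
  rw [hk, hvk, hwk] at hid
  -- the top block vanishes
  have hT : ((fun i => (C ((v ⨯₃ w) i) : ℝ[X])) ⬝ᵥ (G *ᵥ fun i => C ((v ⨯₃ w) i))) = 0 := by
    rw [hG, bilin_pencil_eq_sum]
    exact Finset.sum_eq_zero fun l _ => by rw [hiso l, map_zero, zero_mul]
  -- norm square under `C`
  have hkk : ((fun i => (C ((v ⨯₃ w) i) : ℝ[X])) ⬝ᵥ fun i => C ((v ⨯₃ w) i)) = C ((v ⨯₃ w) ⬝ᵥ (v ⨯₃ w)) := by
    simp only [dotProduct, Fin.sum_univ_three, map_add, map_mul]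
  rw [hT, zero_mul, zero_sub, hkk, ← map_pow] at hid
  rw [hid, hG, bilin_pencil_eq_sum, bilin_pencil_eq_sum]

/-- **MIDDLE WINDOW `≤ 4` ON THE SUB-SUB-STRATUM**: with `k = v × w ≠ 0` isotropic for every core letter, the middle block of the hyperbolic null-top pencil
has at most four positive roots (or is the zero polynomial). [folklore] -/
theorem card_posRoots_middleBlock_le_four_of_isotropic (d : Fin 4 → ℕ) (S : Fin 4 → Matrix (Fin 3) (Fin 3) ℝ) (v w : Fin 3 → ℝ)
    (hk : v ⨯₃ w ≠ 0) (hiso : ∀ l : Fin 3, (v ⨯₃ w) ⬝ᵥ (S (Fin.castSucc l) *ᵥ (v ⨯₃ w)) = 0)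
    (h0 : ((fun i => C (v i)) ⬝ᵥ ((∑ l : Fin 3, ((X : ℝ[X]) ^ d (Fin.castSucc l)) • (S (Fin.castSucc l)).map C).adjugate *ᵥ fun i => C (w i))) ≠ 0) :
    (((fun i => C (v i)) ⬝ᵥ ((∑ l : Fin 3, ((X : ℝ[X]) ^ d (Fin.castSucc l)) • (S (Fin.castSucc l)).map C).adjugate *ᵥ fun i => C (w i))).roots.toFinset.filter
        (fun t => 0 < t)).card ≤ 4 := by
  set m := ((fun i => C (v i)) ⬝ᵥ ((∑ l : Fin 3, ((X : ℝ[X]) ^ d (Fin.castSucc l)) • (S (Fin.castSucc l)).map C).adjugate *ᵥ fun i => C (w i)))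
    with hm
  set A := (∑ l : Fin 3, C ((v ⨯₃ w) ⬝ᵥ (S (Fin.castSucc l) *ᵥ (v ⨯₃ (v ⨯₃ w)))) * (X : ℝ[X]) ^ d (Fin.castSucc l)) with hA
  set B := (∑ l : Fin 3, C ((w ⨯₃ (v ⨯₃ w)) ⬝ᵥ (S (Fin.castSucc l) *ᵥ (v ⨯₃ w))) * (X : ℝ[X]) ^ d (Fin.castSucc l)) with hB
  have hfac : C (((v ⨯₃ w) ⬝ᵥ (v ⨯₃ w)) ^ 2) * m = -(A * B) := by
    rw [hm, hA, hB]; exact middleBlock_mul_normSq_sq_eq_neg_mul_of_isotropic d S v w hiso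
  have hkk : ((v ⨯₃ w) ⬝ᵥ (v ⨯₃ w)) ^ 2 ≠ 0 := by
    have h0' : 0 < (v ⨯₃ w) ⬝ᵥ (v ⨯₃ w) := by
      simpa only [star_trivial] using Matrix.dotProduct_star_self_pos_iff.mpr hk
    positivity
  have hAB : A * B ≠ 0 := by
    intro h
    apply h0
    have : C (((v ⨯₃ w) ⬝ᵥ (v ⨯₃ w)) ^ 2) * m = 0 := by rw [hfac, h, neg_zero]
    rcases mul_eq_zero.mp this with hc | hm0
    · exact absurd (Polynomial.C_eq_zero.mp hc) hkk
    · exact hm0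
  have hA0 : A ≠ 0 := left_ne_zero_of_mul hAB
  have hB0 : B ≠ 0 := right_ne_zero_of_mul hAB
  -- roots of m = roots of A * B (up to the non-zero constant and the sign)
  have hroots : m.roots = (A * B).roots := by
    have h1 : (C (((v ⨯₃ w) ⬝ᵥ (v ⨯₃ w)) ^ 2) * m).roots = m.roots := by
      rw [Polynomial.roots_C_mul _ hkk]
    rw [← h1, hfac, Polynomial.roots_neg]
  rw [hroots]
  exact card_posRoots_mul_le_four hA0 hB0 (card_support_nodeForm_three_le d _) (card_support_nodeForm_three_le d _)

end Summit.ValiantsHypothesis.ValiantsHypothesis.Theorems.LacunarySymmetroidMatrixDescartes.Census
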